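import Summits.AtomisticToContinuum.FouriersLaw.Theorems.BondHeatUncertaintyExtensiveSnapshotIrreversibilityEnergyWindowSkeletonFieldCalculus
import Summits.AtomisticToContinuum.FouriersLaw.Theorems.BondHeatUncertaintyExtensiveSnapshotIrreversibilityEnergyWindowSkeletonIdentities
import Summits.AtomisticToContinuum.FouriersLaw.Theorems.BondHeatUncertaintyExtensiveSnapshotIrreversibilityEnergyWindowSkeletonJacobianMoments
import Literature.Probability.Distributions.GaussianMoments

/-!
# Energy window, part W-2 — the four `L¹` conditions of the arrival identity for a bounded `C¹`
observable with bounded derivative, from (JMˣ)₁ (PROVED, T-a2) and (JMˣ)₂ (hypothesis)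
Lineage `stmt-AtomisticToContinuum-9121` (`ExtensiveSnapshotIrreversibility`), K_fix half, leaf S3;
cell decomp-a2c, lens «grading / quantitative ladder», generation 81, part W «Glues», file 2.
For the ARRIVAL identity of part T-b (`integral_mul_skelWeightArr_eq`: level `m`, `κ > 0`, bath
momentum `b`, start `z`, baths `T_L, T_R ∈ [T/2, 2T]`, `0 ≤ s ≤ 1`) and `g ∈ C¹` with `|g| ≤ M₀`,
`|Dg(w)v| ≤ L‖v‖` (e.g. `g ∈ C¹_c`, part W-3), the four integrability hypotheses `hGu`, `hxGu`,
`hdGu`, `hGdu` HOLD (§4).  §1: `∫⁻ (ofReal f)^n ≠ ⊤ ⇒ f^n ∈ L¹`; Young; `E (Ξ_m B)_j² < ∞` (law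
`skelGauss m`, part S `map_pairSkel_wienerPair`, Literature `integrable_pow_gaussianReal`).  §2:
measurability along the path of `‖DE b_j‖`, `‖∂_{b_j} DE b_l‖` (the flow map is `C^∞` in the
skeleton, R `contDiff_skelFlowMapAt`, so the inner `fderiv` is a genuine derivative).  §3:
`‖DE b_j‖^n ∈ L¹` ((JMˣ)₁ = T-a2 `skeletonJacobianMoments`) and `‖∂_{b_j} DE b_l‖^n ∈ L¹` (hypothesis
(JMˣ)₂ `SkeletonSecondVariationMoments`, T-a1 decl, proved in the tree file V-c).  §4: domination by
W-1's pointwise bounds (`|g u_j| ≤ M₀Kκ⁻¹F_j`, `|x_j g u_j| ≤ M₀Kκ⁻¹(x_j²+F_j²)/2`,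
`|∂_j(g∘E) u_j| ≤ LKκ⁻¹F_j²`, `|g ∂_ju_j| ≤ M₀K(κ⁻¹S_jj + κ⁻²K²·2·2^{-m}Σ_l F_jF_lS_lj)`, `K = 2N`).
Constants are irrelevant (finiteness at fixed `m, κ`).  No instance / notation / option; no proof
holes.  References: D. Nualart, The Malliavin Calculus and Related Topics (2006), Prop. 1.3.1
[cite: Nualart2006, Prop 1.3.1]. [folklore]
-/

noncomputable section

namespace Summit.AtomisticToContinuum.FouriersLaw.Theorems.ExtensiveSnapshotIrreversibility.EnergyWindow

open MeasureTheory ProbabilityTheory Filter Topology Set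
open scoped ENNReal NNReal Matrix ContDiff
open Literature.MathematicalPhysics.KineticTheory.HeatConduction
open Literature.Probability.Process Literature.Probability.Distributions

/-! ## 1. Generic helpers -/

/-- `∫⁻ (ofReal f)^n ≠ ⊤` gives `f^n ∈ L¹` for measurable `f ≥ 0`. [folklore] -/
theorem integrable_pow_of_lintegral_rpow_ne_top {α : Type} [MeasurableSpace α] {μ : Measure α}
    {f : α → ℝ} (hf : Measurable f) (h0 : ∀ a, 0 ≤ f a) (n : ℕ)
    (h : ∫⁻ a, ENNReal.ofReal (f a) ^ (n : ℝ) ∂μ ≠ ⊤) : Integrable (fun a => f a ^ n) μ := by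
  refine (lintegral_ofReal_ne_top_iff_integrable (hf.pow_const n).aestronglyMeasurable
    (Eventually.of_forall fun a => pow_nonneg (h0 a) n)).1 ?_
  have h1 : ∀ a, ENNReal.ofReal (f a ^ n) = ENNReal.ofReal (f a) ^ (n : ℝ) := fun a => by
    rw [ENNReal.ofReal_rpow_of_nonneg (h0 a) (Nat.cast_nonneg n), Real.rpow_natCast]
  simp_rw [h1]
  exact h

/-- Young: `a b ≤ (a² + b²)/2`. [folklore] (dedup gate: public twin Literature.Barriers.RiemannHypothesis.mul_le_half_add_sq in an unrelated module; kept PRIVATE (private copies in W-5A / W-5)) -/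
private theorem mul_le_half_sq_add_sq (a b : ℝ) : a * b ≤ (a ^ 2 + b ^ 2) / 2 := by
  nlinarith [sq_nonneg (a - b)]

/-- Young for three factors: `a b c ≤ ((a⁴ + b⁴)/2 + c²)/2`. [folklore] -/
theorem mul_mul_le_young4 (a b c : ℝ) :
    a * b * c ≤ ((a ^ 4 + b ^ 4) / 2 + c ^ 2) / 2 := by
  have h1 : a * b * c ≤ ((a * b) ^ 2 + c ^ 2) / 2 := mul_le_half_sq_add_sq (a * b) c
  have h2 : (a * b) ^ 2 ≤ (a ^ 4 + b ^ 4) / 2 := by nlinarith [sq_nonneg (a ^ 2 - b ^ 2)]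
  linarith

/-- **Second moment of a skeleton coordinate**: `E (Ξ_m B)_j² < ∞` (law `skelGauss m`). [folklore] -/
theorem integrable_sq_coordX_pairSkel (m : ℕ) (j : Fin (2 ^ m) ⊕ Fin (2 ^ m)) :
    Integrable (fun wp : WienerPair => coordX m (pairSkel m wp) j ^ 2) wienerPair := by
  have h1 : Integrable (fun t : ℝ => t ^ 2) (gaussianReal 0 (skelVar m)) :=
    integrable_pow_gaussianReal 0 (skelVar m) 2
  have h2 : Integrable (fun g : Fin (2 ^ m) ⊕ Fin (2 ^ m) → ℝ => g j ^ 2)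
      (Measure.pi fun _ : Fin (2 ^ m) ⊕ Fin (2 ^ m) => gaussianReal 0 (skelVar m)) :=
    ((measurePreserving_eval (fun _ : Fin (2 ^ m) ⊕ Fin (2 ^ m) => gaussianReal 0 (skelVar m))
      j).integrable_comp h1.aestronglyMeasurable).2 h1
  have h3 : Integrable (fun x : PairSkeleton m => coordX m x j ^ 2) (skelGauss m) := by
    refine ((measurePreserving_skelCoordEquiv m).integrable_comp_emb
      (MeasurableEquiv.measurableEmbedding _)).1 ?_
    have h : (fun x : PairSkeleton m => coordX m x j ^ 2) ∘
        (MeasurableEquiv.sumPiEquivProdPi fun _ : Fin (2 ^ m) ⊕ Fin (2 ^ m) => ℝ) =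
        fun g => g j ^ 2 := by
      funext g; cases j <;> rfl
    rw [h]
    exact h2
  have h4 : Integrable (fun x : PairSkeleton m => coordX m x j ^ 2) (wienerPair.map (pairSkel m)) := by
    rw [map_pairSkel_wienerPair]; exact h3
  exact h4.comp_measurable (measurable_pairSkel m)

/-! ## 2. Measurability along the path -/

section Arrival

variable {ω₂ lam β γ : ℝ} (hω : 0 < ω₂) (hl : 0 < lam) (hβ : 0 < β) (hγ : 0 < γ) {N : ℕ}
  (hN : 0 < N) {T T_L T_R : ℝ} (hT : 0 < T) (hTL : T / 2 ≤ T_L) (hTL' : T_L ≤ 2 * T)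
  (hTR : T / 2 ≤ T_R) (hTR' : T_R ≤ 2 * T)

/-- The pair (skeleton, remainder) of the path is measurable. [folklore] -/
theorem measurable_pairSkel_prodMk_pairRem (m : ℕ) :
    Measurable fun wp : WienerPair => (pairSkel m wp, pairRem m wp) :=
  (measurable_pairSkel m).prodMk (measurable_pairRem m)

include hω hl hβ hγ in
/-- The second skeleton variation is jointly measurable in (skeleton, remainder) (the flow map is
`C^∞` in the skeleton — R `contDiff_skelFlowMapAt` — so the inner `fderiv` is a genuine
derivative). [folklore] -/
theorem measurable_fderiv_fderiv_skelFlowMapAt_apply {s : ℝ} (hs : s ∈ Icc (0 : ℝ) 1) (m : ℕ)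
    (z : PhaseSpace N) (δ δ' : PairSkeleton m) :
    Measurable fun p : PairSkeleton m × WienerPair => fderiv ℝ (fun y =>
      fderiv ℝ (skelFlowMapAt ω₂ lam β γ N T_L T_R s m z p.2) y δ) p.1 δ' := by
  have hF := measurable_fderiv_skelFlowMapAt_apply hω hl.le hβ.le hγ.le N T_L T_R hs m z δ
  have hd : ∀ (r : WienerPair) (x : PairSkeleton m), DifferentiableAt ℝ
      (fun y => fderiv ℝ (skelFlowMapAt ω₂ lam β γ N T_L T_R s m z r) y δ) x :=
    fun r x => differentiable_fderiv_skelFlowMapAt_apply hω hl.le hβ.le hγ.le N T_L T_R hs m z r δ x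
  exact measurable_fderiv_apply_of_param
    (fun p : PairSkeleton m × WienerPair =>
      fderiv ℝ (skelFlowMapAt ω₂ lam β γ N T_L T_R s m z p.2) p.1 δ) hF hd δ'

include hω hl hβ hγ in
/-- `‖DE b‖` along the path is measurable. [folklore] -/
theorem measurable_norm_fderiv_path {s : ℝ} (hs : s ∈ Icc (0 : ℝ) 1) (m : ℕ) (z : PhaseSpace N)
    (δ : PairSkeleton m) :
    Measurable fun wp : WienerPair => ‖fderiv ℝ
      (skelFlowMapAt ω₂ lam β γ N T_L T_R s m z (pairRem m wp)) (pairSkel m wp) δ‖ := by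
  have h := (measurable_fderiv_skelFlowMapAt_apply hω hl.le hβ.le hγ.le N T_L T_R hs m z δ).comp
    (measurable_pairSkel_prodMk_pairRem m)
  exact h.norm

include hω hl hβ hγ in
/-- `‖∂_{δ'} DE δ‖` along the path is measurable. [folklore] -/
theorem measurable_norm_fderiv_fderiv_path {s : ℝ} (hs : s ∈ Icc (0 : ℝ) 1) (m : ℕ)
    (z : PhaseSpace N) (δ δ' : PairSkeleton m) :
    Measurable fun wp : WienerPair => ‖fderiv ℝ (fun y =>
      fderiv ℝ (skelFlowMapAt ω₂ lam β γ N T_L T_R s m z (pairRem m wp)) y δ) (pairSkel m wp) δ'‖ := by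
  have h := (measurable_fderiv_fderiv_skelFlowMapAt_apply (T_L := T_L) (T_R := T_R) hω hl hβ hγ hs
    m z δ δ').comp (measurable_pairSkel_prodMk_pairRem m)
  exact h.norm

/-! ## 3. Moments ⇒ integrability of powers -/

include hω hl hβ hγ hN hT hTL hTL' hTR hTR' in
/-- **`‖DE b‖^n ∈ L¹(wienerPair)`** for every `n ≥ 1` ((JMˣ)₁, PROVED in T-a2). [folklore] -/
theorem integrable_pow_norm_fderiv_path {s : ℝ} (hs : s ∈ Icc (0 : ℝ) 1) (m : ℕ)
    (z : PhaseSpace N) (δ : PairSkeleton m) (n : ℕ) (hn : 1 ≤ n) :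
    Integrable (fun wp : WienerPair => ‖fderiv ℝ
      (skelFlowMapAt ω₂ lam β γ N T_L T_R s m z (pairRem m wp)) (pairSkel m wp) δ‖ ^ n)
      wienerPair := by
  obtain ⟨C, hC⟩ := skeletonJacobianMoments ω₂ lam β γ hω hl hβ hγ T hT N hN n 1
    (by exact_mod_cast hn) one_pos
  have hb := hC T_L T_R hTL hTL' hTR hTR' s hs.1 hs.2 m z δ
  exact integrable_pow_of_lintegral_rpow_ne_top (measurable_norm_fderiv_path hω hl hβ hγ hs m z δ)
    (fun _ => norm_nonneg _) n (ne_top_of_le_ne_top ENNReal.ofReal_ne_top hb)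

include hω hl hβ hγ hN hT hTL hTL' hTR hTR' in
/-- **`‖∂_{δ'} DE δ‖^n ∈ L¹(wienerPair)`** for every `n ≥ 1`, from (JMˣ)₂. [folklore] -/
theorem integrable_pow_norm_fderiv_fderiv_path (hJ2 : SkeletonSecondVariationMoments) {s : ℝ}
    (hs : s ∈ Icc (0 : ℝ) 1) (m : ℕ) (z : PhaseSpace N) (δ δ' : PairSkeleton m) (n : ℕ)
    (hn : 1 ≤ n) :
    Integrable (fun wp : WienerPair => ‖fderiv ℝ (fun y =>
      fderiv ℝ (skelFlowMapAt ω₂ lam β γ N T_L T_R s m z (pairRem m wp)) y δ) (pairSkel m wp) δ'‖ ^ n)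
      wienerPair := by
  obtain ⟨C, hC⟩ := hJ2 ω₂ lam β γ hω hl hβ hγ T hT N hN n 1 (by exact_mod_cast hn) one_pos
  have hb := hC T_L T_R hTL hTL' hTR hTR' s hs.1 hs.2 m z δ δ'
  exact integrable_pow_of_lintegral_rpow_ne_top
    (measurable_norm_fderiv_fderiv_path hω hl hβ hγ hs m z δ δ') (fun _ => norm_nonneg _) n
    (ne_top_of_le_ne_top ENNReal.ofReal_ne_top hb)

/-! ## 4. The four `L¹` conditions of the arrival identity -/

include hω hl hβ hγ in
/-- `wp ↦ g(E(wp))` is measurable for continuous `g`. [folklore] -/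
theorem measurable_comp_skelFlowMapAt_path (s : ℝ) (m : ℕ) (z : PhaseSpace N)
    {g : PhaseSpace N → ℝ} (hg : Continuous g) :
    Measurable fun wp : WienerPair =>
      g (skelFlowMapAt ω₂ lam β γ N T_L T_R s m z (pairRem m wp) (pairSkel m wp)) := by
  have h := (hg.measurable.comp (measurable_skelFlowMapAt hω hl.le hβ.le hγ.le N T_L T_R s m
    z)).comp (measurable_pairSkel_prodMk_pairRem m)
  exact h

include hω hl hβ hγ in
/-- The arrival field along the path is measurable. [folklore] -/
theorem measurable_skelFieldArr_path {s : ℝ} (hs : s ∈ Icc (0 : ℝ) 1) (m : ℕ) (κ : ℝ) (b : Fin N)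
    (z : PhaseSpace N) (j : Fin (2 ^ m) ⊕ Fin (2 ^ m)) :
    Measurable fun wp : WienerPair =>
      skelFieldArr ω₂ lam β γ N T_L T_R s m κ b z (pairRem m wp) (pairSkel m wp) j := by
  have h := (measurable_skelFieldArr_apply hω hl.le hβ.le hγ.le N T_L T_R hs m κ b z j).comp
    (measurable_pairSkel_prodMk_pairRem m)
  exact h

include hω hl hβ hγ in
/-- The skeleton derivative of the arrival field along the path is measurable. [folklore] -/
theorem measurable_fderiv_skelFieldArr_path {s : ℝ} (hs : s ∈ Icc (0 : ℝ) 1) (m : ℕ) {κ : ℝ}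
    (hκ : 0 < κ) (b : Fin N) (z : PhaseSpace N) (j : Fin (2 ^ m) ⊕ Fin (2 ^ m))
    (v : PairSkeleton m) :
    Measurable fun wp : WienerPair => fderiv ℝ (fun y =>
      skelFieldArr ω₂ lam β γ N T_L T_R s m κ b z (pairRem m wp) y j) (pairSkel m wp) v := by
  have hF := measurable_skelFieldArr_apply hω hl.le hβ.le hγ.le N T_L T_R hs m κ b z j
  have hd : ∀ (r : WienerPair) (x : PairSkeleton m), DifferentiableAt ℝ
      (fun y => skelFieldArr ω₂ lam β γ N T_L T_R s m κ b z r y j) x :=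
    fun r x => (contDiff_skelFieldArr_apply hω hl.le hβ.le hγ.le N T_L T_R hs m hκ b z r
      j).differentiable (by simp) x
  have h := (measurable_fderiv_apply_of_param
    (fun p : PairSkeleton m × WienerPair => skelFieldArr ω₂ lam β γ N T_L T_R s m κ b z p.2 p.1 j)
    hF hd v).comp (measurable_pairSkel_prodMk_pairRem m)
  exact h

include hω hl hβ hγ in
/-- The skeleton derivative of `g ∘ E` along the path is measurable (`g ∈ C¹`). [folklore] -/
theorem measurable_fderiv_comp_skelFlowMapAt_path {s : ℝ} (hs : s ∈ Icc (0 : ℝ) 1) (m : ℕ)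
    (z : PhaseSpace N) {g : PhaseSpace N → ℝ} (hg : ContDiff ℝ 1 g) (v : PairSkeleton m) :
    Measurable fun wp : WienerPair => fderiv ℝ (fun y =>
      g (skelFlowMapAt ω₂ lam β γ N T_L T_R s m z (pairRem m wp) y)) (pairSkel m wp) v := by
  have hF : Measurable fun p : PairSkeleton m × WienerPair =>
      g (skelFlowMapAt ω₂ lam β γ N T_L T_R s m z p.2 p.1) :=
    hg.continuous.measurable.comp (measurable_skelFlowMapAt hω hl.le hβ.le hγ.le N T_L T_R s m z)
  have hd : ∀ (r : WienerPair) (x : PairSkeleton m), DifferentiableAt ℝ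
      (fun y => g (skelFlowMapAt ω₂ lam β γ N T_L T_R s m z r y)) x :=
    fun r x => ((hg.differentiable one_ne_zero).comp
      ((contDiff_skelFlowMapAt hω hl.le hβ.le hγ.le N T_L T_R hs m z r).differentiable
        (by simp))) x
  have h := (measurable_fderiv_apply_of_param
    (fun p : PairSkeleton m × WienerPair => g (skelFlowMapAt ω₂ lam β γ N T_L T_R s m z p.2 p.1))
    hF hd v).comp (measurable_pairSkel_prodMk_pairRem m)
  exact h

include hω hl hβ hγ hN hT hTL hTL' hTR hTR' in
/-- **hGu**: `g(E) u_j ∈ L¹` for bounded continuous-differentiable `g`. [folklore] -/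
theorem integrable_mul_skelFieldArr {s : ℝ} (hs : s ∈ Icc (0 : ℝ) 1) (m : ℕ) {κ : ℝ}
    (hκ : 0 < κ) (b : Fin N) (z : PhaseSpace N) {g : PhaseSpace N → ℝ} (hg : ContDiff ℝ 1 g)
    {M₀ : ℝ} (hgM : ∀ w, |g w| ≤ M₀) (j : Fin (2 ^ m) ⊕ Fin (2 ^ m)) :
    Integrable (fun wp =>
      g (skelFlowMapAt ω₂ lam β γ N T_L T_R s m z (pairRem m wp) (pairSkel m wp)) *
        skelFieldArr ω₂ lam β γ N T_L T_R s m κ b z (pairRem m wp) (pairSkel m wp) j) wienerPair := by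
  have hM₀ : 0 ≤ M₀ := (abs_nonneg _).trans (hgM 0)
  have hF1 := integrable_pow_norm_fderiv_path hω hl hβ hγ hN hT hTL hTL' hTR hTR' hs m z
    (basisX m j) 1 le_rfl
  refine Integrable.mono'
    (hF1.const_mul (M₀ * ((Fintype.card (Fin N ⊕ Fin N) : ℝ) * κ⁻¹)))
    ((measurable_comp_skelFlowMapAt_path hω hl hβ hγ s m z hg.continuous).mul
      (measurable_skelFieldArr_path hω hl hβ hγ hs m κ b z j)).aestronglyMeasurable
    (Eventually.of_forall fun wp => ?_)
  rw [Real.norm_eq_abs, abs_mul, pow_one]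
  have hu := abs_skelFieldArr_le (ω₂ := ω₂) (lam := lam) (β := β) (γ := γ) N T_L T_R s m hκ b z
    (pairRem m wp) (pairSkel m wp) j
  calc _ ≤ M₀ * ((Fintype.card (Fin N ⊕ Fin N) : ℝ) * κ⁻¹ *
        ‖fderiv ℝ (skelFlowMapAt ω₂ lam β γ N T_L T_R s m z (pairRem m wp)) (pairSkel m wp)
          (basisX m j)‖) := mul_le_mul (hgM _) hu (abs_nonneg _) hM₀
    _ = _ := by ring

include hω hl hβ hγ hN hT hTL hTL' hTR hTR' in
/-- **hxGu**: `x_j g(E) u_j ∈ L¹`. [folklore] -/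
theorem integrable_coordX_mul_mul_skelFieldArr {s : ℝ} (hs : s ∈ Icc (0 : ℝ) 1) (m : ℕ) {κ : ℝ}
    (hκ : 0 < κ) (b : Fin N) (z : PhaseSpace N) {g : PhaseSpace N → ℝ} (hg : ContDiff ℝ 1 g)
    {M₀ : ℝ} (hgM : ∀ w, |g w| ≤ M₀) (j : Fin (2 ^ m) ⊕ Fin (2 ^ m)) :
    Integrable (fun wp => coordX m (pairSkel m wp) j *
      (g (skelFlowMapAt ω₂ lam β γ N T_L T_R s m z (pairRem m wp) (pairSkel m wp)) *
        skelFieldArr ω₂ lam β γ N T_L T_R s m κ b z (pairRem m wp) (pairSkel m wp) j))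
      wienerPair := by
  have hM₀ : 0 ≤ M₀ := (abs_nonneg _).trans (hgM 0)
  have hF2 := integrable_pow_norm_fderiv_path hω hl hβ hγ hN hT hTL hTL' hTR hTR' hs m z
    (basisX m j) 2 one_le_two
  have hX2 := integrable_sq_coordX_pairSkel m j
  refine Integrable.mono'
    (((hX2.add hF2).div_const 2).const_mul
      (M₀ * ((Fintype.card (Fin N ⊕ Fin N) : ℝ) * κ⁻¹)))
    (((measurable_coordX m j).comp (measurable_pairSkel m)).mul
      ((measurable_comp_skelFlowMapAt_path hω hl hβ hγ s m z hg.continuous).mul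
        (measurable_skelFieldArr_path hω hl hβ hγ hs m κ b z j))).aestronglyMeasurable
    (Eventually.of_forall fun wp => ?_)
  rw [Real.norm_eq_abs, abs_mul, abs_mul]
  have hu := abs_skelFieldArr_le (ω₂ := ω₂) (lam := lam) (β := β) (γ := γ) N T_L T_R s m hκ b z
    (pairRem m wp) (pairSkel m wp) j
  have hK0 : 0 ≤ (Fintype.card (Fin N ⊕ Fin N) : ℝ) * κ⁻¹ := by positivity
  have hy : |coordX m (pairSkel m wp) j| *
      ‖fderiv ℝ (skelFlowMapAt ω₂ lam β γ N T_L T_R s m z (pairRem m wp)) (pairSkel m wp)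
        (basisX m j)‖ ≤ (coordX m (pairSkel m wp) j ^ 2 +
      ‖fderiv ℝ (skelFlowMapAt ω₂ lam β γ N T_L T_R s m z (pairRem m wp)) (pairSkel m wp)
        (basisX m j)‖ ^ 2) / 2 := by
    have h := mul_le_half_sq_add_sq |coordX m (pairSkel m wp) j|
      ‖fderiv ℝ (skelFlowMapAt ω₂ lam β γ N T_L T_R s m z (pairRem m wp)) (pairSkel m wp)
        (basisX m j)‖
    rwa [sq_abs] at h
  calc |coordX m (pairSkel m wp) j| * (|g (skelFlowMapAt ω₂ lam β γ N T_L T_R s m z (pairRem m wp)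
        (pairSkel m wp))| * |skelFieldArr ω₂ lam β γ N T_L T_R s m κ b z (pairRem m wp)
          (pairSkel m wp) j|)
      ≤ |coordX m (pairSkel m wp) j| * (M₀ * ((Fintype.card (Fin N ⊕ Fin N) : ℝ) * κ⁻¹ *
          ‖fderiv ℝ (skelFlowMapAt ω₂ lam β γ N T_L T_R s m z (pairRem m wp)) (pairSkel m wp)
            (basisX m j)‖)) :=
        mul_le_mul_of_nonneg_left (mul_le_mul (hgM _) hu (abs_nonneg _) hM₀) (abs_nonneg _)
    _ = M₀ * ((Fintype.card (Fin N ⊕ Fin N) : ℝ) * κ⁻¹) * (|coordX m (pairSkel m wp) j| *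
          ‖fderiv ℝ (skelFlowMapAt ω₂ lam β γ N T_L T_R s m z (pairRem m wp)) (pairSkel m wp)
            (basisX m j)‖) := by ring
    _ ≤ M₀ * ((Fintype.card (Fin N ⊕ Fin N) : ℝ) * κ⁻¹) * ((coordX m (pairSkel m wp) j ^ 2 +
          ‖fderiv ℝ (skelFlowMapAt ω₂ lam β γ N T_L T_R s m z (pairRem m wp)) (pairSkel m wp)
            (basisX m j)‖ ^ 2) / 2) :=
        mul_le_mul_of_nonneg_left hy (mul_nonneg hM₀ hK0)
    _ = _ := by simp only [Pi.add_apply]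

include hω hl hβ hγ hN hT hTL hTL' hTR hTR' in
/-- **hdGu**: `∂_j(g∘E) u_j ∈ L¹` for `g ∈ C¹` with `|Dg(w)v| ≤ L‖v‖`. [folklore] -/
theorem integrable_fderiv_comp_mul_skelFieldArr {s : ℝ} (hs : s ∈ Icc (0 : ℝ) 1) (m : ℕ) {κ : ℝ}
    (hκ : 0 < κ) (b : Fin N) (z : PhaseSpace N) {g : PhaseSpace N → ℝ} (hg : ContDiff ℝ 1 g)
    {L : ℝ} (hgL : ∀ w v, |fderiv ℝ g w v| ≤ L * ‖v‖) (j : Fin (2 ^ m) ⊕ Fin (2 ^ m)) :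
    Integrable (fun wp =>
      fderiv ℝ (fun y => g (skelFlowMapAt ω₂ lam β γ N T_L T_R s m z (pairRem m wp) y))
          (pairSkel m wp) (basisX m j) *
        skelFieldArr ω₂ lam β γ N T_L T_R s m κ b z (pairRem m wp) (pairSkel m wp) j) wienerPair := by
  have hF2 := integrable_pow_norm_fderiv_path hω hl hβ hγ hN hT hTL hTL' hTR hTR' hs m z
    (basisX m j) 2 one_le_two
  refine Integrable.mono'
    (hF2.const_mul (L * ((Fintype.card (Fin N ⊕ Fin N) : ℝ) * κ⁻¹)))
    ((measurable_fderiv_comp_skelFlowMapAt_path hω hl hβ hγ hs m z hg (basisX m j)).mul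
      (measurable_skelFieldArr_path hω hl hβ hγ hs m κ b z j)).aestronglyMeasurable
    (Eventually.of_forall fun wp => ?_)
  rw [Real.norm_eq_abs, abs_mul,
    fderiv_comp_skelFlowMapAt_apply hω hl.le hβ.le hγ.le N T_L T_R hs m z (pairRem m wp)
      (pairSkel m wp) ((hg.differentiable one_ne_zero) _) (basisX m j)]
  have hu := abs_skelFieldArr_le (ω₂ := ω₂) (lam := lam) (β := β) (γ := γ) N T_L T_R s m hκ b z
    (pairRem m wp) (pairSkel m wp) j
  have hg1 := hgL (skelFlowMapAt ω₂ lam β γ N T_L T_R s m z (pairRem m wp) (pairSkel m wp))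
    (fderiv ℝ (skelFlowMapAt ω₂ lam β γ N T_L T_R s m z (pairRem m wp)) (pairSkel m wp)
      (basisX m j))
  calc _ ≤ L * ‖fderiv ℝ (skelFlowMapAt ω₂ lam β γ N T_L T_R s m z (pairRem m wp)) (pairSkel m wp)
          (basisX m j)‖ * (((Fintype.card (Fin N ⊕ Fin N) : ℝ) * κ⁻¹) *
        ‖fderiv ℝ (skelFlowMapAt ω₂ lam β γ N T_L T_R s m z (pairRem m wp)) (pairSkel m wp)
          (basisX m j)‖) :=
        mul_le_mul hg1 hu (abs_nonneg _) ((abs_nonneg _).trans hg1)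
    _ = _ := by ring

include hω hl hβ hγ hN hT hTL hTL' hTR hTR' in
/-- **hGdu**: `g(E) ∂_j u_j ∈ L¹` for bounded `g ∈ C¹`, from (JMˣ)₁ and (JMˣ)₂ via W-1's bound on
`∂_j u_j` (implicit differentiation of `(Γ+κ)⁻¹`). [folklore] -/
theorem integrable_mul_fderiv_skelFieldArr (hJ2 : SkeletonSecondVariationMoments) {s : ℝ}
    (hs : s ∈ Icc (0 : ℝ) 1) (m : ℕ) {κ : ℝ} (hκ : 0 < κ) (b : Fin N) (z : PhaseSpace N)
    {g : PhaseSpace N → ℝ} (hg : ContDiff ℝ 1 g) {M₀ : ℝ} (hgM : ∀ w, |g w| ≤ M₀)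
    (j : Fin (2 ^ m) ⊕ Fin (2 ^ m)) :
    Integrable (fun wp =>
      g (skelFlowMapAt ω₂ lam β γ N T_L T_R s m z (pairRem m wp) (pairSkel m wp)) *
        fderiv ℝ (fun y => skelFieldArr ω₂ lam β γ N T_L T_R s m κ b z (pairRem m wp) y j)
          (pairSkel m wp) (basisX m j)) wienerPair := by
  have hM₀ : 0 ≤ M₀ := (abs_nonneg _).trans (hgM 0)
  -- the random quantities along the path: `F l = ‖DE b_l‖`, `S l = ‖∂_j DE b_l‖`
  set F : (Fin (2 ^ m) ⊕ Fin (2 ^ m)) → WienerPair → ℝ := fun l wp =>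
    ‖fderiv ℝ (skelFlowMapAt ω₂ lam β γ N T_L T_R s m z (pairRem m wp)) (pairSkel m wp)
      (basisX m l)‖ with hFdef
  set S : (Fin (2 ^ m) ⊕ Fin (2 ^ m)) → WienerPair → ℝ := fun l wp =>
    ‖fderiv ℝ (fun y => fderiv ℝ (skelFlowMapAt ω₂ lam β γ N T_L T_R s m z (pairRem m wp)) y
      (basisX m l)) (pairSkel m wp) (basisX m j)‖ with hSdef
  have hFi : ∀ l (n : ℕ), 1 ≤ n → Integrable (fun wp => F l wp ^ n) wienerPair := fun l n hn =>
    integrable_pow_norm_fderiv_path hω hl hβ hγ hN hT hTL hTL' hTR hTR' hs m z (basisX m l) n hn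
  have hSi : ∀ l (n : ℕ), 1 ≤ n → Integrable (fun wp => S l wp ^ n) wienerPair := fun l n hn =>
    integrable_pow_norm_fderiv_fderiv_path hω hl hβ hγ hN hT hTL hTL' hTR hTR' hJ2 hs m z
      (basisX m l) (basisX m j) n hn
  -- constants
  have hK0 : 0 ≤ (Fintype.card (Fin N ⊕ Fin N) : ℝ) := Nat.cast_nonneg _
  have hκ0 : 0 ≤ κ⁻¹ := inv_nonneg.2 hκ.le
  -- integrable dominator `D'` (Young) of the pointwise bound `D`
  have hD'i : Integrable (fun wp => M₀ * ((Fintype.card (Fin N ⊕ Fin N) : ℝ) *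
      (κ⁻¹ * S j wp + κ⁻¹ * (κ⁻¹ * ((Fintype.card (Fin N ⊕ Fin N) : ℝ) ^ 2 * (2 *
        (((2 : ℝ) ^ m)⁻¹ * ∑ l, (((F j wp ^ 4 + F l wp ^ 4) / 2 + S l wp ^ 2) / 2)))))))) wienerPair := by
    have h1 : Integrable (fun wp => S j wp) wienerPair := by
      simpa only [pow_one] using hSi j 1 le_rfl
    have h2 : Integrable (fun wp => ∑ l, (((F j wp ^ 4 + F l wp ^ 4) / 2 + S l wp ^ 2) / 2))
        wienerPair :=
      integrable_finsetSum _ fun l _ =>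
        ((((hFi j 4 (by norm_num)).add (hFi l 4 (by norm_num))).div_const 2).add
          (hSi l 2 one_le_two)).div_const 2
    have h3 : Integrable (fun wp => κ⁻¹ * (κ⁻¹ * ((Fintype.card (Fin N ⊕ Fin N) : ℝ) ^ 2 * (2 *
        (((2 : ℝ) ^ m)⁻¹ * ∑ l, (((F j wp ^ 4 + F l wp ^ 4) / 2 + S l wp ^ 2) / 2)))))) wienerPair :=
      ((((h2.const_mul (((2 : ℝ) ^ m)⁻¹)).const_mul 2).const_mul
        ((Fintype.card (Fin N ⊕ Fin N) : ℝ) ^ 2)).const_mul κ⁻¹).const_mul κ⁻¹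
    exact (((h1.const_mul κ⁻¹).add h3).const_mul _).const_mul M₀
  refine Integrable.mono' hD'i
    ((measurable_comp_skelFlowMapAt_path hω hl hβ hγ s m z hg.continuous).mul
      (measurable_fderiv_skelFieldArr_path hω hl hβ hγ hs m hκ b z j (basisX m j))).aestronglyMeasurable
    (Eventually.of_forall fun wp => ?_)
  rw [Real.norm_eq_abs, abs_mul]
  have hdu := abs_fderiv_skelFieldArr_le hω hl.le hβ.le hγ.le N T_L T_R hs m hκ b z (pairRem m wp)
    (pairSkel m wp) (basisX m j) j
  -- Young on the cubic terms
  have hsum : F j wp * ∑ l, F l wp * S l wp ≤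
      ∑ l, (((F j wp ^ 4 + F l wp ^ 4) / 2 + S l wp ^ 2) / 2) := by
    rw [Finset.mul_sum]
    refine Finset.sum_le_sum fun l _ => ?_
    rw [← mul_assoc]
    exact mul_mul_le_young4 _ _ _
  have hD : (Fintype.card (Fin N ⊕ Fin N) : ℝ) *
      (κ⁻¹ * S j wp + F j wp * (κ⁻¹ * (κ⁻¹ * ((Fintype.card (Fin N ⊕ Fin N) : ℝ) ^ 2 * (2 *
        (((2 : ℝ) ^ m)⁻¹ * ∑ l, F l wp * S l wp)))))) ≤
      (Fintype.card (Fin N ⊕ Fin N) : ℝ) *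
      (κ⁻¹ * S j wp + κ⁻¹ * (κ⁻¹ * ((Fintype.card (Fin N ⊕ Fin N) : ℝ) ^ 2 * (2 *
        (((2 : ℝ) ^ m)⁻¹ * ∑ l, (((F j wp ^ 4 + F l wp ^ 4) / 2 + S l wp ^ 2) / 2)))))) := by
    refine mul_le_mul_of_nonneg_left (add_le_add le_rfl ?_) hK0
    calc F j wp * (κ⁻¹ * (κ⁻¹ * ((Fintype.card (Fin N ⊕ Fin N) : ℝ) ^ 2 * (2 *
          (((2 : ℝ) ^ m)⁻¹ * ∑ l, F l wp * S l wp)))))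
        = κ⁻¹ * (κ⁻¹ * ((Fintype.card (Fin N ⊕ Fin N) : ℝ) ^ 2 * (2 *
          (((2 : ℝ) ^ m)⁻¹ * (F j wp * ∑ l, F l wp * S l wp))))) := by ring
      _ ≤ κ⁻¹ * (κ⁻¹ * ((Fintype.card (Fin N ⊕ Fin N) : ℝ) ^ 2 * (2 *
          (((2 : ℝ) ^ m)⁻¹ * ∑ l, (((F j wp ^ 4 + F l wp ^ 4) / 2 + S l wp ^ 2) / 2))))) := by
        gcongr
  exact (mul_le_mul (hgM _) (hdu.trans hD) (abs_nonneg _) hM₀)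

end Arrival

end Summit.AtomisticToContinuum.FouriersLaw.Theorems.ExtensiveSnapshotIrreversibility.EnergyWindow

end
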